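/-
Copyright (c) 2026. All rights reserved.
Released under Apache 2.0 license as described in the file LICENSE.
-/
import Mathlib.RingTheory.WittVector.Complete
import Mathlib.Algebra.Polynomial.Degree.Lemmas
import Mathlib.Algebra.Polynomial.Div
import Mathlib.FieldTheory.IsAlgClosed.Basic
import HarnessLib

/-!
# Witt vectors: the range of `W(j)` is cut out by polynomial equations

Pure-algebra lemma Λ0 of the programme `(A_max(F))^{Γ_F} = W(k_F)` (the `k = 0` layer of the input
`B_max(F)^{Γ_F} = F₀` of the D2-cris repair, `SoloInformedRepairD2Cris.lean` §4; the analytic layers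
`A_inf → B_max⁺ → W(𝒪_ℂ/𝔪)` and the finish via `B_dR^{Γ_F} = F` are separate files).

**Statement.** Let `j : k₁ → k` be a ring map of perfect integral domains of characteristic `p` whose
image is *algebraically closed in `k`*: every root in `k` of a nonzero polynomial with coefficients in
`k₁` lies in `j(k₁)` (automatic when `k₁` is an algebraically closed field, §4).  Then a Witt vector
`w ∈ W(k)` which is a root of a NONZERO polynomial with coefficients in `W(k₁)` lies in `W(j)(W(k₁))`
(`mem_range_map_of_eval_eq_zero`, `mem_range_map_of_eval₂_eq_zero`,
`mem_range_map_of_eval_eq_zero_of_isAlgClosed`).  This is the Witt-vector form of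
"`W(k₁)[1/p]` is algebraically closed in the unramified extension `W(k)[1/p]` when `k₁` is algebraically
closed in `k`".

**Proof** (successive approximation, entirely on Witt components — no completeness, no valuations):
strip the `p`-content of `G` (`exists_eq_C_pow_mul`: `G = p^e G'` with `G' mod p ≠ 0`), reduce modulo `p`
(`eval_map_constantCoeff`) to get `w₀ = j a₀` from the hypothesis on `j`, write `w = [w₀] + p·w'`
(`exists_eq_teichmuller_add_mul`), substitute `G₁(X) = G'(pX + [a₀])`, which is again nonzero with root
`w'` (`comp_affine_ne_zero`, `eval_map_comp_affine`), and induct (`exists_forall_coeff_eq`): since the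
first `n + 1` components of `[t] + p·x` only depend on the first `n` components of `x`
(`forall_coeff_p_mul_eq`, `forall_coeff_add_eq`), `w` agrees with some `W(j) z_N` in its first `N`
components for every `N`, hence all its components lie in `j(k₁)`.

References: Serre, *Local Fields* (GTM 67), Ch. II §§5–6; Fontaine, *Le corps des périodes p-adiques*,
Astérisque 223 (1994), Exp. II §1.
-/

noncomputable section

open Polynomial

namespace Summit.Langlands.Langlands.Theorems

namespace WittIntegralRange

variable {p : ℕ} [hp : Fact p.Prime]

/-! ### §1 Low Witt components of sums and of `p · x` -/

section Coeff

variable {k : Type*} [CommRing k]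

/-- Two Witt vectors agree in their first `n` components iff their `n`-truncations agree. [folklore] -/
theorem forall_coeff_eq_iff_truncate_eq {x y : WittVector p k} {n : ℕ} :
    (∀ i < n, x.coeff i = y.coeff i) ↔ WittVector.truncate n x = WittVector.truncate n y := by
  refine ⟨fun h => ?_, fun h i hi => ?_⟩
  · ext i
    simp only [WittVector.coeff_truncate]
    exact h i i.isLt
  · rw [← WittVector.coeff_truncate x ⟨i, hi⟩, ← WittVector.coeff_truncate y ⟨i, hi⟩, h]

/-- If `x ≡ y` and `x' ≡ y'` in the first `n` Witt components, then `x + x' ≡ y + y'` there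
(the Witt addition polynomials `S_i` only involve components of index `≤ i`). [folklore] -/
theorem forall_coeff_add_eq {x y x' y' : WittVector p k} {n : ℕ}
    (h : ∀ i < n, x.coeff i = y.coeff i) (h' : ∀ i < n, x'.coeff i = y'.coeff i) :
    ∀ i < n, (x + x').coeff i = (y + y').coeff i := by
  rw [forall_coeff_eq_iff_truncate_eq] at h h' ⊢
  rw [map_add, map_add, h, h']

/-- `constantCoeff ∘ W(j) = j ∘ constantCoeff`. [folklore] -/
theorem constantCoeff_comp_map {k' : Type*} [CommRing k'] (j : k →+* k') :
    (WittVector.constantCoeff : WittVector p k' →+* k').comp (WittVector.map j) =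
      j.comp WittVector.constantCoeff := by
  ext x
  simp [WittVector.map_coeff]

variable [CharP k p]

/-- `(p · x)₀ = 0` in characteristic `p`. [folklore] -/
theorem coeff_p_mul_zero (x : WittVector p k) : ((p : WittVector p k) * x).coeff 0 = 0 := by
  rw [mul_comm]; exact WittVector.mul_charP_coeff_zero x

/-- `(p · x)_{i+1} = x_i^p` in characteristic `p` (`p = V ∘ F`). [folklore] -/
theorem coeff_p_mul_succ (x : WittVector p k) (i : ℕ) :
    ((p : WittVector p k) * x).coeff (i + 1) = x.coeff i ^ p := by
  rw [mul_comm]; exact WittVector.mul_charP_coeff_succ x i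

/-- The first `n + 1` components of `p · x` only depend on the first `n` components of `x`. [folklore] -/
theorem forall_coeff_p_mul_eq {x y : WittVector p k} {n : ℕ} (h : ∀ i < n, x.coeff i = y.coeff i) :
    ∀ i < n + 1, ((p : WittVector p k) * x).coeff i = ((p : WittVector p k) * y).coeff i := by
  intro i hi
  cases i with
  | zero => rw [coeff_p_mul_zero, coeff_p_mul_zero]
  | succ i => rw [coeff_p_mul_succ, coeff_p_mul_succ, h i (by omega)]

end Coeff

/-! ### §2 Perfect coefficient rings: `w = [w₀] + p · w'`; the `p`-content of a polynomial -/

section Perfect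

variable {k : Type*} [CommRing k] [CharP k p] [PerfectRing k p]

/-- Over a perfect ring, a Witt vector with vanishing zeroth component is a multiple of `p`
(Mathlib's `WittVector.mem_span_p_iff_coeff_zero_eq_zero`). [folklore] -/
theorem p_dvd_of_coeff_zero_eq_zero {x : WittVector p k} (h : x.coeff 0 = 0) :
    (p : WittVector p k) ∣ x :=
  Ideal.mem_span_singleton.mp ((WittVector.mem_span_p_iff_coeff_zero_eq_zero x).mpr h)

/-- **`w = [w₀] + p · w'`** over a perfect ring of characteristic `p`.
[cite: SerreLocalFields1979, Ch. II §5] -/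
theorem exists_eq_teichmuller_add_mul (w : WittVector p k) :
    ∃ w' : WittVector p k, w = WittVector.teichmuller p (w.coeff 0) + (p : WittVector p k) * w' := by
  have h0 : (w - WittVector.teichmuller p (w.coeff 0)).coeff 0 = 0 := by
    rw [← WittVector.constantCoeff_apply, map_sub, WittVector.constantCoeff_apply,
      WittVector.constantCoeff_apply, WittVector.teichmuller_coeff_zero, sub_self]
  obtain ⟨w', hw'⟩ := p_dvd_of_coeff_zero_eq_zero h0
  exact ⟨w', by rw [← hw']; ring⟩

/-- A polynomial over `W(k)` whose reduction modulo `p` vanishes is divisible by `p` (perfect `k`).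
[folklore] -/
theorem C_dvd_of_map_constantCoeff_eq_zero {G : (WittVector p k)[X]}
    (h : G.map (WittVector.constantCoeff : WittVector p k →+* k) = 0) :
    C (p : WittVector p k) ∣ G := by
  rw [C_dvd_iff_dvd_coeff]
  intro i
  apply p_dvd_of_coeff_zero_eq_zero
  have hi := congrArg (fun P : k[X] => P.coeff i) h
  simpa only [coeff_map, coeff_zero, WittVector.constantCoeff_apply] using hi

/-- `p`-content stripping, inductive form: if some coefficient of `G` has a nonzero Witt component of
index `m`, then `G = p^e · G'` with `G' mod p ≠ 0`. [folklore] -/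
theorem exists_eq_C_pow_mul_aux (m : ℕ) :
    ∀ (G : (WittVector p k)[X]) (d : ℕ), (G.coeff d).coeff m ≠ 0 →
      ∃ (e : ℕ) (G' : (WittVector p k)[X]), G = C ((p : WittVector p k) ^ e) * G' ∧
        G'.map (WittVector.constantCoeff : WittVector p k →+* k) ≠ 0 := by
  induction m with
  | zero =>
    intro G d hd
    refine ⟨0, G, by simp, fun h => hd ?_⟩
    have hi := congrArg (fun P : k[X] => P.coeff d) h
    simpa only [coeff_map, coeff_zero, WittVector.constantCoeff_apply] using hi
  | succ m ih =>
    intro G d hd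
    by_cases hbar : G.map (WittVector.constantCoeff : WittVector p k →+* k) = 0
    · obtain ⟨G₂, hG₂⟩ := C_dvd_of_map_constantCoeff_eq_zero hbar
      have hd₂ : (G₂.coeff d).coeff m ≠ 0 := by
        intro h0
        apply hd
        rw [hG₂, coeff_C_mul, coeff_p_mul_succ, h0, zero_pow hp.out.ne_zero]
      obtain ⟨e, G', hG', hG'bar⟩ := ih G₂ d hd₂
      refine ⟨e + 1, G', ?_, hG'bar⟩
      rw [hG₂, hG', ← mul_assoc, ← C_mul, ← pow_succ']
    · exact ⟨0, G, by simp, hbar⟩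

/-- **`p`-content.** A nonzero `G ∈ W(k)[X]` (`k` perfect) is `p^e · G'` with `G' mod p ≠ 0`.
[folklore] -/
theorem exists_eq_C_pow_mul {G : (WittVector p k)[X]} (hG : G ≠ 0) :
    ∃ (e : ℕ) (G' : (WittVector p k)[X]), G = C ((p : WittVector p k) ^ e) * G' ∧
      G'.map (WittVector.constantCoeff : WittVector p k →+* k) ≠ 0 := by
  obtain ⟨d, hd⟩ : ∃ d, G.coeff d ≠ 0 := by
    by_contra h
    push Not at h
    exact hG (Polynomial.ext fun d => by simpa using h d)
  obtain ⟨m, hm⟩ : ∃ m, (G.coeff d).coeff m ≠ 0 := by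
    by_contra h
    push Not at h
    exact hd (WittVector.ext fun m => by simpa using h m)
  exact exists_eq_C_pow_mul_aux m G d hm

end Perfect

/-! ### §3 Roots in `W(k)` of polynomials over `W(k₁)` -/

section Root

variable {k₁ k : Type*} [CommRing k₁] [CommRing k] (j : k₁ →+* k)

/-- Reduction modulo `p` of a root: `G(w) = 0` in `W(k)` gives `Ḡ(w₀) = 0` in `k`, where `Ḡ ∈ k₁[X]` is
`G mod p` pushed along `j`. [folklore] -/
theorem eval_map_constantCoeff {G : (WittVector p k₁)[X]} {w : WittVector p k}
    (hw : (G.map (WittVector.map j)).eval w = 0) :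
    ((G.map (WittVector.constantCoeff : WittVector p k₁ →+* k₁)).map j).eval (w.coeff 0) = 0 := by
  have h := congrArg (WittVector.constantCoeff : WittVector p k →+* k) hw
  rw [map_zero, eval_map, hom_eval₂, constantCoeff_comp_map, WittVector.constantCoeff_apply] at h
  rwa [map_map, eval_map]

/-- Roots transform under the affine substitution: `G(pX + t)` at `w'` is `G` at `p · w' + W(j) t`.
[folklore] -/
theorem eval_map_comp_affine (G : (WittVector p k₁)[X]) (t : WittVector p k₁) (w' : WittVector p k) :
    ((G.comp (C (p : WittVector p k₁) * X + C t)).map (WittVector.map j)).eval w' =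
      (G.map (WittVector.map j)).eval ((p : WittVector p k) * w' + WittVector.map j t) := by
  simp [map_comp, eval_comp]

section DomainK

variable [CharP k p] [IsDomain k]

/-- A root of `p^e · G'` in the domain `W(k)` is a root of `G'`. [folklore] -/
theorem eval_map_eq_zero_of_C_pow_mul {G' : (WittVector p k₁)[X]} {e : ℕ} {w : WittVector p k}
    (hw : ((C ((p : WittVector p k₁) ^ e) * G').map (WittVector.map j)).eval w = 0) :
    (G'.map (WittVector.map j)).eval w = 0 := by
  rw [Polynomial.map_mul, map_C, eval_mul, eval_C, map_pow, map_natCast] at hw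
  exact (mul_eq_zero.mp hw).resolve_left (pow_ne_zero _ (WittVector.p_nonzero p k))

end DomainK

section DomainK₁

variable [CharP k₁ p] [IsDomain k₁]

/-- The affine substitution `X ↦ pX + t` does not kill a nonzero polynomial over the domain `W(k₁)`
(`p ≠ 0` there). [folklore] -/
theorem comp_affine_ne_zero {G : (WittVector p k₁)[X]} (hG : G ≠ 0) (t : WittVector p k₁) :
    G.comp (C (p : WittVector p k₁) * X + C t) ≠ 0 := by
  intro h
  rcases comp_eq_zero_iff.mp h with h0 | ⟨-, hq⟩
  · exact hG h0
  · have h1 := congrArg (fun q : (WittVector p k₁)[X] => q.coeff 1) hq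
    simp only [coeff_add, coeff_C_mul, coeff_X_one, mul_one, coeff_C, Nat.one_ne_zero, if_false,
      add_zero] at h1
    exact WittVector.p_nonzero p k₁ h1

end DomainK₁

variable [CharP k₁ p] [PerfectRing k₁ p] [IsDomain k₁] [CharP k p] [PerfectRing k p] [IsDomain k]

/-- **Successive approximation.** If every root in `k` of a nonzero polynomial over `k₁` lies in
`j(k₁)`, then a root `w ∈ W(k)` of a nonzero `G ∈ W(k₁)[X]` agrees with some `W(j) z` in its first `N`
components, for every `N` (induction on `N` through `G ↦ p^{-e} G (pX + [a₀])`).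
[cite: SerreLocalFields1979, Ch. II §§5–6] -/
theorem exists_forall_coeff_eq
    (hj : ∀ g : k₁[X], g ≠ 0 → ∀ y : k, (g.map j).eval y = 0 → y ∈ j.range) (N : ℕ) :
    ∀ (G : (WittVector p k₁)[X]), G ≠ 0 → ∀ w : WittVector p k,
      (G.map (WittVector.map j)).eval w = 0 →
        ∃ z : WittVector p k₁, ∀ i < N, w.coeff i = (WittVector.map j z).coeff i := by
  induction N with
  | zero => exact fun G _ w _ => ⟨0, fun i hi => absurd hi (Nat.not_lt_zero i)⟩
  | succ N ih =>
    intro G hG w hw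
    -- strip the `p`-content of `G`
    obtain ⟨e, G', hGG', hbar⟩ := exists_eq_C_pow_mul hG
    rw [hGG'] at hw
    have hw' : (G'.map (WittVector.map j)).eval w = 0 := eval_map_eq_zero_of_C_pow_mul j hw
    have hG' : G' ≠ 0 := by
      rintro rfl
      exact hbar (Polynomial.map_zero _)
    -- reduce modulo `p`: `w₀ = j a₀`
    obtain ⟨a₀, ha₀⟩ := RingHom.mem_range.mp (hj _ hbar (w.coeff 0) (eval_map_constantCoeff j hw'))
    -- `w = [w₀] + p · w'`
    obtain ⟨w', hww'⟩ := exists_eq_teichmuller_add_mul w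
    -- substitute `X ↦ pX + [a₀]`
    have hG₁ : G'.comp (C (p : WittVector p k₁) * X + C (WittVector.teichmuller p a₀)) ≠ 0 :=
      comp_affine_ne_zero hG' _
    have hw₁ : ((G'.comp (C (p : WittVector p k₁) * X + C (WittVector.teichmuller p a₀))).map
        (WittVector.map j)).eval w' = 0 := by
      rw [eval_map_comp_affine, WittVector.map_teichmuller, ha₀, add_comm, ← hww']
      exact hw'
    obtain ⟨z', hz'⟩ := ih _ hG₁ w' hw₁
    refine ⟨WittVector.teichmuller p a₀ + (p : WittVector p k₁) * z', ?_⟩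
    have key : ∀ i < N + 1,
        (WittVector.teichmuller p (w.coeff 0) + (p : WittVector p k) * w').coeff i =
          (WittVector.teichmuller p (w.coeff 0) +
            (p : WittVector p k) * WittVector.map j z').coeff i :=
      forall_coeff_add_eq (fun _ _ => rfl) (forall_coeff_p_mul_eq hz')
    intro i hi
    rw [map_add, map_mul, map_natCast, WittVector.map_teichmuller, ha₀, ← key i hi, ← hww']

/-- **Λ0 (the range of `W(j)` is cut out by polynomial equations).** If every root in `k` of a nonzero
polynomial over `k₁` lies in `j(k₁)` (`k₁` algebraically closed in `k`), then a root `w ∈ W(k)` of a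
nonzero polynomial over `W(k₁)` lies in the range of `W(j) : W(k₁) → W(k)`.
[cite: SerreLocalFields1979, Ch. II §§5–6] -/
theorem mem_range_map_of_eval_eq_zero
    (hj : ∀ g : k₁[X], g ≠ 0 → ∀ y : k, (g.map j).eval y = 0 → y ∈ j.range)
    {G : (WittVector p k₁)[X]} (hG : G ≠ 0) {w : WittVector p k}
    (hw : (G.map (WittVector.map j)).eval w = 0) : w ∈ (WittVector.map j).range := by
  have h : ∀ i, ∃ z : WittVector p k₁, w.coeff i = j (z.coeff i) := fun i => by
    obtain ⟨z, hz⟩ := exists_forall_coeff_eq j hj (i + 1) G hG w hw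
    exact ⟨z, by rw [hz i (Nat.lt_succ_self i), WittVector.map_coeff]⟩
  choose z hz using h
  refine RingHom.mem_range.mpr ⟨WittVector.mk p fun i => (z i).coeff i, ?_⟩
  ext i
  simp only [WittVector.map_coeff, WittVector.coeff_mk]
  exact (hz i).symm

/-- **Λ0**, with the root hypothesis in `eval₂` form. [cite: SerreLocalFields1979, Ch. II §§5–6] -/
theorem mem_range_map_of_eval₂_eq_zero
    (hj : ∀ g : k₁[X], g ≠ 0 → ∀ y : k, (g.map j).eval y = 0 → y ∈ j.range)
    {G : (WittVector p k₁)[X]} (hG : G ≠ 0) {w : WittVector p k}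
    (hw : G.eval₂ (WittVector.map j) w = 0) : w ∈ (WittVector.map j).range :=
  mem_range_map_of_eval_eq_zero j hj hG (by rwa [eval_map])

end Root

/-! ### §4 Algebraically closed `k₁`: no hypothesis on `j` -/

section AlgClosed

variable {k₁ k : Type*} [Field k₁] [IsAlgClosed k₁] [CommRing k] [IsDomain k] (j : k₁ →+* k)

/-- Over an algebraically closed field `k₁`, every root in a domain `k ⊇ j(k₁)` of a nonzero `g ∈ k₁[X]`
lies in `j(k₁)` (induction on the degree, splitting off a root). [folklore] -/
theorem mem_range_of_eval_map_eq_zero (n : ℕ) :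
    ∀ g : k₁[X], g.natDegree ≤ n → g ≠ 0 → ∀ y : k, (g.map j).eval y = 0 → y ∈ j.range := by
  induction n with
  | zero =>
    intro g hn hg y hy
    refine absurd ?_ hg
    rw [eq_C_of_natDegree_le_zero hn] at hy ⊢
    rw [map_C, eval_C, map_eq_zero_iff j j.injective] at hy
    rw [hy, C_0]
  | succ n ih =>
    intro g hn hg y hy
    by_cases hle : g.natDegree ≤ n
    · exact ih g hle hg y hy
    have hdeg : g.degree ≠ 0 := fun h0 =>
      hle (by rw [natDegree_eq_zero_iff_degree_le_zero.mpr h0.le]; exact Nat.zero_le n)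
    obtain ⟨α, hα⟩ := IsAlgClosed.exists_root g hdeg
    have hmul : (X - C α) * (g /ₘ (X - C α)) = g := mul_divByMonic_eq_iff_isRoot.mpr hα
    have hg₂ : g /ₘ (X - C α) ≠ 0 := fun h => hg (by rw [← hmul, h, mul_zero])
    have hn₂ : (g /ₘ (X - C α)).natDegree ≤ n := by
      rw [natDegree_divByMonic g (monic_X_sub_C α), natDegree_X_sub_C]
      omega
    have hy' : (y - j α) * ((g /ₘ (X - C α)).map j).eval y = 0 := by
      rw [← hmul, Polynomial.map_mul, Polynomial.map_sub, map_X, map_C, eval_mul, eval_sub, eval_X,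
        eval_C] at hy
      exact hy
    rcases mul_eq_zero.mp hy' with h1 | h2
    · exact RingHom.mem_range.mpr ⟨α, (sub_eq_zero.mp h1).symm⟩
    · exact ih _ hn₂ hg₂ y h2

variable [CharP k₁ p] [PerfectRing k₁ p] [CharP k p] [PerfectRing k p]

/-- **Λ0 for algebraically closed `k₁`.** A root `w ∈ W(k)` (`k` a perfect domain of characteristic `p`)
of a nonzero polynomial over `W(k₁)`, `k₁ ⊆ k` algebraically closed, lies in `W(k₁)`:
`w ∈ range W(j)`. This is the form used for `k₁ = k̄_F ⊆ 𝒪_{ℂ_F}/𝔪`.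
[cite: SerreLocalFields1979, Ch. II §§5–6] -/
theorem mem_range_map_of_eval_eq_zero_of_isAlgClosed {G : (WittVector p k₁)[X]} (hG : G ≠ 0)
    {w : WittVector p k} (hw : (G.map (WittVector.map j)).eval w = 0) :
    w ∈ (WittVector.map j).range :=
  mem_range_map_of_eval_eq_zero j
    (fun g hg y hy => mem_range_of_eval_map_eq_zero j g.natDegree g le_rfl hg y hy) hG hw

/-- **Λ0 for algebraically closed `k₁`**, `eval₂` form. [cite: SerreLocalFields1979, Ch. II §§5–6] -/
theorem mem_range_map_of_eval₂_eq_zero_of_isAlgClosed {G : (WittVector p k₁)[X]} (hG : G ≠ 0)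
    {w : WittVector p k} (hw : G.eval₂ (WittVector.map j) w = 0) :
    w ∈ (WittVector.map j).range :=
  mem_range_map_of_eval_eq_zero_of_isAlgClosed j hG (by rwa [eval_map])

end AlgClosed

end WittIntegralRange

end Summit.Langlands.Langlands.Theorems
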